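import Summits.PneNP.PneNP.Theorems.KarlinRubinMonotoneSufficesGreedyErrors
import Summits.PneNP.PneNP.Theorems.KarlinRubinMonotoneSufficesGreedyPools
import Summits.PneNP.PneNP.Theorems.KarlinRubinMonotoneSufficesGreedyHyper
import Summits.PneNP.PneNP.Theorems.KarlinRubinMonotoneSufficesGreedyAverage
import Summits.PneNP.PneNP.Theorems.KarlinRubinMonotoneSufficesGreedyParamsB
import Summits.PneNP.PneNP.Theorems.KarlinRubinMonotoneSufficesGreedyParamsC

/-!
# Crux `MonotoneSuffices` (stmt-PneNP-18026), the GREEDY general detector — part 11: one `n`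

For one `n` satisfying the base inequalities (notation of parts 10b–10d: `k, L, Q, t, M, θ`,
`s₁ = (k/(16n))^t 2^{t(t-1)/2}`, `R = ⌈(L+1)/s₁⌉`), the five ingredients (H0)–(H4) of the averaging (part 8) hold
with `e₀ = e₁ = exp(-(L+1)⁶/512)`, `e_b = e^{-(L+1)}/…`, `e_h = 2^{-k}`, so there are `R` candidate tables `cs` with
`#{x : det accepts x} · C(n,k) + Σ_A #{z : det rejects plant A z} ≤ C(n,k) 2^{#E} · 5 e^{-(L+1)}` (`greedy_counts`).
-/

set_option linter.dupNamespace false -- `Summit.PneNP.PneNP.…`: summit = sub-problem name (D-0017 single-conjunct layout)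

namespace Summit.PneNP.PneNP.Theorems.MonotoneSuffices.Greedy

open Finset Real
open Literature.Probability.RandomGraphs.PlantedClique
open Summit.PneNP.PneNP.Theorems.MonotoneSuffices.Room

/-- **The hypergeometric ingredient (H4).** For `#W ≤ tM`: the `k`-sets with fewer than `⌊k/2⌋` vertices off `W`
number at most `C(n,k) 2^{-k}`. [folklore] -/
theorem card_fewOff_le {n k t M : ℕ} (h32 : 32 * (t * M) ≤ n) (h6k : 6 * k ≤ n) (hk : 1 ≤ k)
    (W : Finset (Fin n)) (hW : #W ≤ t * M) :
    (#((powersetCard k (univ : Finset (Fin n))).filter fun A => #(A \ W) < k / 2) : ℝ) ≤ (n.choose k : ℝ) * (2 : ℝ)⁻¹ ^ k := by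
  classical
  set s := k - k / 2 with hs
  -- `#(A \ W) < k/2` forces `s ≤ #(A ∩ W)`
  have hsub : ((powersetCard k (univ : Finset (Fin n))).filter fun A => #(A \ W) < k / 2) ⊆
      (powersetCard k (univ : Finset (Fin n))).filter fun A => s ≤ #(A ∩ W) := by
    intro A hA
    rw [mem_filter] at hA ⊢
    refine ⟨hA.1, ?_⟩
    have hcard : #(A \ W) + #(A ∩ W) = #A := card_sdiff_add_card_inter A W
    rw [(mem_powersetCard.1 hA.1).2] at hcard
    omega
  have hsk : s ≤ k := Nat.sub_le _ _
  have hmain := card_filter_le_inter_mul_choose_le W hsk (n := n) (k := k)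
  have hmono : (#W).choose s * k.choose s ≤ (t * M).choose s * k.choose s :=
    Nat.mul_le_mul_right _ (Nat.choose_le_choose s hW)
  have hhyp := hyper6 (n := n) (k := k) (t := t) (M := M) h32 h6k hk
  have hns : 0 < n.choose s := Nat.choose_pos (by omega)
  have hns' : (0 : ℝ) < n.choose s := by exact_mod_cast hns
  -- `#bad · C(n,s) ≤ C(n,k) C(tM,s) C(k,s) ≤ C(n,k) C(n,s) 2^{-k}`
  have h1 : (#((powersetCard k (univ : Finset (Fin n))).filter fun A => s ≤ #(A ∩ W)) : ℝ) * n.choose s ≤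
      (n.choose k : ℝ) * ((n.choose s : ℝ) * (2 : ℝ)⁻¹ ^ k) := by
    have h : (#((powersetCard k (univ : Finset (Fin n))).filter fun A => s ≤ #(A ∩ W))) * n.choose s ≤
        n.choose k * ((t * M).choose s * k.choose s) := hmain.trans (Nat.mul_le_mul_left _ hmono)
    have h' : ((#((powersetCard k (univ : Finset (Fin n))).filter fun A => s ≤ #(A ∩ W)) * n.choose s : ℕ) : ℝ) ≤
        ((n.choose k * ((t * M).choose s * k.choose s) : ℕ) : ℝ) := by exact_mod_cast h
    push_cast at h'
    have h'' : (n.choose k : ℝ) * (((t * M).choose s : ℝ) * (k.choose s : ℝ)) ≤ (n.choose k : ℝ) * ((n.choose s : ℝ) * (2 : ℝ)⁻¹ ^ k) := by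
      refine mul_le_mul_of_nonneg_left ?_ (Nat.cast_nonneg _)
      have := hhyp; push_cast at this; exact this
    exact h'.trans h''
  have h2 : (#((powersetCard k (univ : Finset (Fin n))).filter fun A => #(A \ W) < k / 2) : ℝ) ≤
      #((powersetCard k (univ : Finset (Fin n))).filter fun A => s ≤ #(A ∩ W)) := by exact_mod_cast card_le_card hsub
  have h3 : (#((powersetCard k (univ : Finset (Fin n))).filter fun A => s ≤ #(A ∩ W)) : ℝ) ≤ (n.choose k : ℝ) * (2 : ℝ)⁻¹ ^ k := by
    have := h1
    rw [show (n.choose k : ℝ) * ((n.choose s : ℝ) * (2 : ℝ)⁻¹ ^ k) = ((n.choose k : ℝ) * (2 : ℝ)⁻¹ ^ k) * n.choose s by ring] at this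
    exact le_of_mul_le_mul_right this hns'
  exact h2.trans h3

/-- **One `n`: the counts of the greedy detector.** Under the base inequalities at `n`, some `R = ⌈(L+1)/s₁⌉` tables
`cs` satisfy `#{x : det accepts} · C(n,k) + Σ_{#A = k} #{z : det rejects plant A z} ≤ C(n,k) · 2^{#E} · 5 e^{-(L+1)}`.
[folklore] -/
theorem greedy_counts {δ : ℝ} {n k L Q t M θ : ℕ} (hδ : 0 < δ)
    (hL : L = Nat.log 2 n) (hQ : Q = n * (L + 1) ^ 6 / k ^ 2 + 1) (ht : t = Nat.log 2 Q + 1) (hM : M = 4 * n / k + 1)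
    (hθ : θ = n / 2 ^ t + k / 4 + 1) (hn : 2048 ≤ n) (hkBig : 640 * (L + 1) ^ 6 ≤ k) (h6k : 6 * k ≤ n)
    (hk2 : k ^ 2 ≤ 4 * n) :
    ∃ cs : Fin ⌈((L : ℝ) + 1) / (((k : ℝ) / (16 * n)) ^ t * 2 ^ (t * (t - 1) / 2))⌉₊ → Fin t → Fin M → Fin n,
      (#((univ : Finset (EdgeVec n)).filter fun x => detOut x cs θ = true) : ℝ) * n.choose k +
        ∑ A ∈ powersetCard k (univ : Finset (Fin n)),
          (#((univ : Finset (EdgeVec n)).filter fun z => detOut (plant A z) cs θ = false) : ℝ) ≤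
      (n.choose k : ℝ) * 2 ^ Fintype.card (⊤ : SimpleGraph (Fin n)).edgeSet * (5 * Real.exp (-((L : ℝ) + 1))) := by
  classical
  have _ := hδ
  obtain ⟨hQt, ht2Q, hQk, hQk', ht1, ht7, h160, h4n, hMn, htMk, h2tk, hLn, hnL, hL11, h80, h32, h16⟩ :=
    natFacts6 hL hQ ht hM hn hkBig h6k hk2
  obtain ⟨hμlo', hμhi, hμ160⟩ := mu_bounds6 hQt ht2Q hQk hQk' hk2 hkBig hL11
  have hn0 : 0 < n := by omega
  have hk1 : 1 ≤ k := by omega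
  have hk8 : 8 ≤ k := by omega
  have hk32 : 32 ≤ k := by omega
  have h2t : 2 * t ≤ k := by omega
  have hQk'' : n * (L + 1) ^ 6 < 2 ^ t * k ^ 2 := hQk'.trans_le (Nat.mul_le_mul_right _ hQt.le)
  obtain ⟨hη0, hη2, hηθ, hnulltail⟩ := nullSide6 (M := M) hθ hμ160 hμhi htMk hk8
  obtain ⟨hη₁0, hη₁1, htn, hθ₁, hpltail⟩ := plantedSide6 hθ hμ160 hμhi htMk hk32 h16 hQk''
  have hbad := badNoise6 (L := L) hμ160 (by omega) ht1 (by
    have : L + 1 ≤ (L + 1) ^ 6 := by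
      calc L + 1 = (L + 1) ^ 1 := (pow_one _).symm
        _ ≤ (L + 1) ^ 6 := Nat.pow_le_pow_right (by omega) (by norm_num)
    omega)
  obtain ⟨hs0, hs1, hkM, hthread⟩ := threading6 (M := M) hn0 h2tk h2t h4n
  set s₁ : ℝ := ((k : ℝ) / (16 * n)) ^ t * 2 ^ (t * (t - 1) / 2) with hs₁
  have hslo : ((16 * (n : ℝ)) ^ t)⁻¹ ≤ s₁ := by
    have hn' : (0 : ℝ) < n := by exact_mod_cast hn0
    calc ((16 * (n : ℝ)) ^ t)⁻¹ = (1 / (16 * (n : ℝ))) ^ t := by rw [one_div, inv_pow]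
      _ ≤ ((k : ℝ) / (16 * n)) ^ t :=
          pow_le_pow_left₀ (by positivity) (div_le_div_of_nonneg_right (by exact_mod_cast hk1) (by positivity)) t
      _ ≤ ((k : ℝ) / (16 * n)) ^ t * 2 ^ (t * (t - 1) / 2) :=
          le_mul_of_one_le_right (by positivity) (one_le_pow₀ (by norm_num))
  obtain ⟨hR1, -, hRe, hR2⟩ := trials6 hs0 hs1 hslo hnL ht7 hL11 hkBig hn0
  set R := ⌈((L : ℝ) + 1) / s₁⌉₊ with hR
  -- the ingredients of the averaging
  set P : ℝ := (2 : ℝ) ^ Fintype.card (⊤ : SimpleGraph (Fin n)).edgeSet with hP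
  set e : ℝ := Real.exp (-(((L : ℝ) + 1) ^ 6 / 512)) with he
  set Bad : Finset (Fin n) → EdgeVec n → Prop := fun A z => ∃ T ∈ A.powerset, #T < t ∧
    2 * (((n - #A : ℕ) : ℝ) * (2 : ℝ)⁻¹ ^ #T) ≤ #((univ \ A).filter (AdjAll z T)) with hBad
  have H0 : ∀ ω : Fin t → Fin M → Fin n, (#((univ : Finset (EdgeVec n)).filter fun x => trialOut x ω θ = true) : ℝ) ≤ P * e := by
    intro ω
    refine (card_trialOut_le ω θ hη0 hη2 (by omega) hηθ).trans ?_
    exact mul_le_mul_of_nonneg_left hnulltail (by positivity)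
  have H1 : ∀ A ∈ powersetCard k (univ : Finset (Fin n)), (#((univ : Finset (EdgeVec n)).filter (Bad A)) : ℝ) ≤
      P * Real.exp (-((L : ℝ) + 1)) := by
    intro A hA
    have hAk : #A = k := (mem_powersetCard.1 hA).2
    have h := card_badNoise_le A t
    simp only [hAk] at h
    simp only [hBad, hAk]
    refine h.trans ?_
    rw [hP, mul_comm ((2 : ℝ) ^ k), mul_assoc]
    refine mul_le_mul_of_nonneg_left ?_ (by positivity)
    rw [mul_comm]; exact hbad
  have H2 : ∀ A ∈ powersetCard k (univ : Finset (Fin n)), ∀ z, ¬ Bad A z →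
      s₁ * Fintype.card (Fin t → Fin M → Fin n) ≤
        #((univ : Finset (Fin t → Fin M → Fin n)).filter fun ω => ∃ T ⊆ A, run (plant A z) ω t = some T) := by
    intro A hA z hz
    have hAk : #A = k := (mem_powersetCard.1 hA).2
    have hgood : ∀ T ∈ A.powerset, #T < t → (#((univ \ A).filter (AdjAll z T)) : ℝ) < 2 * (((n - #A : ℕ) : ℝ) * (2 : ℝ)⁻¹ ^ #T) := by
      intro T hT hTt
      by_contra hc
      exact hz ⟨T, hT, hTt, not_lt.1 hc⟩
    have hcnt := card_runsInto_ge_of_good A z t M hgood (by rw [hAk]; exact hkM)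
    rw [hAk] at hcnt
    exact hthread _ hcnt
  have H3 : ∀ (ω : Fin t → Fin M → Fin n), ∀ A ∈ powersetCard k (univ : Finset (Fin n)), k / 2 ≤ #(A \ candSet ω) →
      (#((univ : Finset (EdgeVec n)).filter fun z =>
        (∃ T ⊆ A, run (plant A z) ω t = some T) ∧ trialOut (plant A z) ω θ = false) : ℝ) ≤ P * e := by
    intro ω A hA ha
    have hAk : #A = k := (mem_powersetCard.1 hA).2
    have h := card_runsInto_not_trialOut_le ω A θ (k / 2) hη₁0 (hAk ▸ hη₁1) (by rw [hAk]; exact htn) ha (by rw [hAk]; exact hθ₁)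
    rw [hAk] at h
    exact h.trans (mul_le_mul_of_nonneg_left hpltail (by positivity))
  have H4 : ∀ W : Finset (Fin n), #W ≤ t * M →
      (#((powersetCard k (univ : Finset (Fin n))).filter fun A => #(A \ W) < k / 2) : ℝ) ≤ (n.choose k : ℝ) * (2 : ℝ)⁻¹ ^ k :=
    fun W hW => card_fewOff_le h32 h6k hk1 W hW
  obtain ⟨cs, hcs⟩ := exists_tables hn0 t M R θ k (k / 2) Bad (e₁ := e) (Real.exp_pos _).le hs1 H0 H1 H2 H3 H4
  refine ⟨cs, hcs.trans ?_⟩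
  -- `R e + (1-s₁)^R + e^{-(L+1)} + R (e + 2^{-k}) ≤ 5 e^{-(L+1)}`
  refine mul_le_mul_of_nonneg_left ?_ (by positivity)
  have hRe' : (R : ℝ) * e ≤ Real.exp (-((L : ℝ) + 1)) := hRe
  nlinarith [hR1, hR2, hRe', Real.exp_pos (-((L : ℝ) + 1))]

end Summit.PneNP.PneNP.Theorems.MonotoneSuffices.Greedy

namespace Summit.PneNP.PneNP.Theorems.MonotoneSuffices.Greedy

open Finset

/-- Registered sub-goal `greedy_step` of stmt-PneNP-18026 (greedy detector, part 11): the hypergeometric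
ingredient, exported verbatim. [folklore] -/
theorem greedy_step :
    ∀ {n k t M : ℕ}, 32 * (t * M) ≤ n → 6 * k ≤ n → 1 ≤ k → ∀ (W : Finset (Fin n)), #W ≤ t * M → (#((Finset.powersetCard k (Finset.univ : Finset (Fin n))).filter fun A => #(A \ W) < k / 2) : ℝ) ≤ (n.choose k : ℝ) * (2 : ℝ)⁻¹ ^ k :=
  fun h32 h6k hk W hW => card_fewOff_le h32 h6k hk W hW

end Summit.PneNP.PneNP.Theorems.MonotoneSuffices.Greedy
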